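import Literature.NumberTheory.LFunctions.Zhang2022.RepairGapPartIIIDoors
import Literature.NumberTheory.LFunctions.Zhang2022.Section15ResidueRstar
import HarnessLib

/-!
# Zhang (2022), rescue GAP/BED (D-0124 (3)(4)): §15 p. 88 «By Lemma 5.8, `ℛ₁* = β₁β₂L′(1,χ) + O(1/𝓛²⁴)`»
# under the minimum premise `‖L(1,χ)‖ ≤ 𝓛⁻¹⁵` (GAP G-31 «(A)-exponent E: main terms only E ≥ 15»; node (18.1) inputs)

Topic `Literature/NumberTheory/LFunctions/Zhang2022` (Landau–Siegel audit tree; verdict-neutral).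
Y. Zhang, *Discrete mean estimates and the Landau–Siegel zero*, arXiv:2211.02515v1 (2022)
[Zhang2022LandauSiegel] — **an unrefereed manuscript under adjudication; nothing in this file asserts or
denies its Theorems 1–2, and nothing here is a claim about Landau–Siegel zeros. The programme SEARCHES and
TYPES; no claim about Landau–Siegel zeros, Theorems 1–2 of arXiv:2211.02515 or a repaired Margin232 until a
kernel theorem says so.**

DAG node `Z22:§15.u058` (§15 p. 88, tex L4376–L4378; `Typed.Section15C.Step15_u058`): «By Lemma 5.8,
`ℛ₁* = β₁β₂L′(1,χ) + O(1/𝓛²⁴)`», `ℛ₁* = L(1+β₁,χ)L(1+β₂,χ)δ(1)/L′(1,χ)`. The tree proves it under the printed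
Assumption (A) from the CLAIM node `Skeleton.Lemma54` (`ResidueValues.step15_u058_of_lemma54`), consuming (A) only
through Lemma 5.8 at `1+β₁`, `1+β₂` and Lemma 5.7's `‖L′(1,χ)‖ ≥ c`. Here the same estimate, SAME CONSTANT, is proved
for all large `D` and every real primitive `χ (mod D)` with `‖L(1,χ)‖ ≤ 𝓛⁻¹⁵` — the tree's proof verbatim with the two
(A)-doors replaced by their minimum-premise twins (`Repair.Gap.lemma58_of_norm_le_pow15`, p561913;
`Repair.Gap.norm_deriv_LFunction_one_ge_pow15`, file `RepairGapPartIIIDoors`) — and hence under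
`Repair.Bed.AssumptionAWith E` for every real `E ≥ 15` (the printed (A) is `E = 2022`, under which the transfer lemma
`Repair.Gap.forAllLarge_assumptionA_of_pow15` gives back exactly the tree's node `ResidueValues.step15_u058_of_lemma54` — not
restated here). With the sibling file
`RepairGapSection16RhoPremise` (`𝓡₂*`, `𝓡₂ⱼ`) this covers the «by Lemma 5.8» residue evaluations of §§15–16 that
feed node (18.1). Theorems only; no definition, no named fact; nothing about (A) itself.

## References

* Y. Zhang, arXiv:2211.02515v1 (2022), §15 pp. 83, 88; §5 Lemmas 5.4, 5.7, 5.8.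
  [cite: Zhang2022LandauSiegel, §15 p. 88]
-/

noncomputable section

open Complex Real Filter Topology

namespace Literature.NumberTheory.LFunctions.Zhang2022.Repair.Gap

open Literature.NumberTheory.LFunctions.Zhang2022.Skeleton
open Literature.NumberTheory.LFunctions.Zhang2022.Typed.Section15C
open Literature.NumberTheory.LFunctions.Zhang2022.Repair.Bed (AssumptionAWith)

variable (c' : ℝ) (X : Typed.Section15C.Inputs15AB)

/-- **Z22:§15.u058 under the minimum premise ⇐ Lemma 5.4 (ii) + the `𝓛⁻¹⁵` doors** (twin of
`ResidueValues.step15_u058_of_lemma54`, same `O`-constant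
`32e^{9/2}π³C₄ + 6πC₈(1 + C₄π) + C₈²(1 + C₄π)/c`, `C₈ = 1 + 1600e^{9/2}π²`, `c = 1/(4e)`): for every instantiation
`X` of the §15A/B objects whose field `ℛ₁*` is the printed `L(1+β₁,χ)L(1+β₂,χ)δ(1)/L′(1,χ)`, for all large `D` and every
real primitive `χ (mod D)` with `‖L(1,χ)‖ ≤ 𝓛⁻¹⁵`: `‖ℛ₁* − β₁β₂L′(1,χ)‖ ≤ C𝓛⁻²⁴`. `Skeleton.Lemma54` is a HYPOTHESIS
(CLAIM node of §5), exactly as in the tree. [cite: Zhang2022LandauSiegel, §15 p. 88] -/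
theorem step15_u058_pow15_of_lemma54
    (hX : ∀ (D : ℕ) [NeZero D] (χ : DirichletCharacter ℂ D),
      X.calR1star c' χ = χ.LFunction (1 + beta1 c' D) * χ.LFunction (1 + beta2 c' D) /
        deriv χ.LFunction 1 * deltaW D 1)
    (h54 : Lemma54) : ∃ C : ℝ, ForAllLarge fun D _ χ => ‖χ.LFunction 1‖ ≤ 1 / Real.log D ^ 15 →
      ‖X.calR1star c' χ - beta1 c' D * beta2 c' D * deriv χ.LFunction 1‖ ≤ C / ell D ^ 24 := by
  obtain ⟨k, C₄, h54'⟩ := h54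
  obtain ⟨c, hc, h57⟩ := norm_deriv_LFunction_one_ge_pow15
  obtain ⟨D₀, hall⟩ := h54'.and h57
  -- the constant of Lemma 5.8 with `K = 10`
  set C₈ : ℝ := 1 + 16 * Real.exp (9 / 2) * π ^ 2 * 10 ^ 2 with hC₈
  have hC₈0 : 0 ≤ C₈ := by positivity
  refine ⟨32 * Real.exp (9 / 2) * π ^ 3 * max C₄ 0 + 6 * π * C₈ * (1 + max C₄ 0 * π) +
      C₈ ^ 2 * (1 + max C₄ 0 * π) / c,
    max D₀ (max ⌈Real.exp 3⌉₊ ⌈Real.exp (14 * |c'| * π)⌉₊), fun D _ χ hD hq hp h15 => ?_⟩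
  have hD₀ : D₀ ≤ D := le_trans (le_max_left _ _) hD
  obtain ⟨hL, he⟩ := ResidueValues.thresholds c' (le_trans (le_max_right _ _) hD)
  have hℓ : 0 < ell D := by linarith
  have hℓ1 : 1 ≤ ell D := by linarith
  have hL' : 3 ≤ Real.log D := hL
  have hα := ResidueValues.alpha_pos hL
  have hαeq := Section2.alpha_eq_pi_div_ell9 D
  obtain ⟨g54, g57⟩ := hall D χ hD₀ hq hp
  have hcL := g57 h15
  set L1 : ℂ := deriv χ.LFunction 1 with hL1
  have hN : 0 < ‖L1‖ := lt_of_lt_of_le hc hcL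
  have hL0 : L1 ≠ 0 := fun h => by rw [h, norm_zero] at hN; exact lt_irrefl _ hN
  -- Lemma 5.4 (ii) at `s = 1`
  have hδ : ‖deltaW D 1 - 1‖ ≤ max C₄ 0 * alpha D * Real.log (ell D) := by
    have h := (g54 1).2 (by rw [sub_self, norm_zero]; positivity)
    refine h.trans ?_
    have hlog : 0 ≤ Real.log (ell D) := Real.log_nonneg hℓ1
    gcongr
    exact le_max_left _ _
  -- Lemma 5.8 at `s = 1 + β₁` and `s = 1 + β₂`
  have hKL : 10 * π ≤ Real.log D ^ 8 := by
    have h3 : (3 : ℝ) ^ 8 ≤ Real.log D ^ 8 := pow_le_pow_left₀ (by norm_num) hL' 8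
    nlinarith [Real.pi_lt_four]
  have hβ1 := ResidueValues.norm_beta1_le c' hL he
  have hβ2 := ResidueValues.norm_beta2_le c' hL he
  have hs1 : ‖(1 + beta1 c' D) - 1‖ ≤ 10 * π / Real.log D ^ 9 := by
    rw [add_sub_cancel_left]
    refine hβ1.trans ?_
    rw [hαeq, ell]; rw [mul_div_assoc']; gcongr; norm_num
  have hs2 : ‖(1 + beta2 c' D) - 1‖ ≤ 10 * π / Real.log D ^ 9 := by
    rw [add_sub_cancel_left]
    refine hβ2.trans ?_
    rw [hαeq, ell]; rw [mul_div_assoc']; gcongr; norm_num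
  have hr1 := lemma58_of_norm_le_pow15 χ hp hL' h15 hKL hs1
  have hr2 := lemma58_of_norm_le_pow15 χ hp hL' h15 hKL hs2
  rw [add_sub_cancel_left] at hr1 hr2
  -- the three remainders
  set r₁ : ℂ := χ.LFunction (1 + beta1 c' D) - L1 * beta1 c' D with hr₁
  set r₂ : ℂ := χ.LFunction (1 + beta2 c' D) - L1 * beta2 c' D with hr₂
  set r₃ : ℂ := deltaW D 1 - 1 with hr₃
  have hr1' : ‖r₁‖ ≤ C₈ / ell D ^ 15 := by rw [hr₁, hC₈]; exact hr1
  have hr2' : ‖r₂‖ ≤ C₈ / ell D ^ 15 := by rw [hr₂, hC₈]; exact hr2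
  have hr3' : ‖r₃‖ ≤ max C₄ 0 * alpha D * Real.log (ell D) := hδ
  -- the identity
  have hid : X.calR1star c' χ - beta1 c' D * beta2 c' D * L1 =
      beta1 c' D * beta2 c' D * L1 * r₃ + (beta1 c' D * r₂ + beta2 c' D * r₁) * (1 + r₃) +
        r₁ * r₂ * (1 + r₃) / L1 := by
    have e1 : χ.LFunction (1 + beta1 c' D) = beta1 c' D * L1 + r₁ := by rw [hr₁]; ring
    have e2 : χ.LFunction (1 + beta2 c' D) = beta2 c' D * L1 + r₂ := by rw [hr₂]; ring
    have e3 : deltaW D 1 = 1 + r₃ := by rw [hr₃]; ring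
    rw [hX D χ, e1, e2, e3]
    exact ResidueValues.rstar_sub_main_eq hL0
  rw [hid]
  -- sizes
  have hLu : ‖L1‖ ≤ 4 * Real.exp (9 / 2) * ell D ^ 2 := by
    refine (ResidueValues.norm_deriv_LFunction_one_le χ hL hp).trans ?_
    have h2 : (1 + ell D) * ell D ≤ 2 * ell D ^ 2 := by nlinarith
    have h3 := mul_le_mul_of_nonneg_left h2 (by positivity : (0 : ℝ) ≤ 2 * Real.exp (9 / 2))
    calc 2 * Real.exp (9 / 2) * (1 + ell D) * ell D = 2 * Real.exp (9 / 2) * ((1 + ell D) * ell D) := by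
          ring
      _ ≤ 2 * Real.exp (9 / 2) * (2 * ell D ^ 2) := h3
      _ = 4 * Real.exp (9 / 2) * ell D ^ 2 := by ring
  have hlogℓ : Real.log (ell D) ≤ ell D := (Real.log_le_sub_one_of_pos hℓ).trans (by linarith)
  have hlog0 : 0 ≤ Real.log (ell D) := Real.log_nonneg hℓ1
  have hαℓ9 : alpha D * ell D ^ 9 = π := by rw [hαeq]; field_simp
  have hαlog : alpha D * Real.log (ell D) ≤ π := by
    calc alpha D * Real.log (ell D) ≤ alpha D * ell D ^ 9 := by
          refine mul_le_mul_of_nonneg_left (hlogℓ.trans ?_) hα.le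
          calc ell D = ell D ^ 1 := (pow_one _).symm
            _ ≤ ell D ^ 9 := pow_le_pow_right₀ hℓ1 (by norm_num)
      _ = π := hαℓ9
  have h1r3 : ‖1 + r₃‖ ≤ 1 + max C₄ 0 * π := by
    refine (norm_add_le _ _).trans ?_
    rw [norm_one]
    have : ‖r₃‖ ≤ max C₄ 0 * π := hr3'.trans (by
      rw [mul_assoc]; exact mul_le_mul_of_nonneg_left hαlog (le_max_right _ _))
    linarith
  -- term 1: `|β₁β₂L′ r₃| ≤ 32 e^{9/2} π³ C₄ / 𝓛²⁴`
  have T1 : ‖beta1 c' D * beta2 c' D * L1 * r₃‖ ≤ 32 * Real.exp (9 / 2) * π ^ 3 * max C₄ 0 / ell D ^ 24 := by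
    rw [norm_mul, norm_mul, norm_mul]
    calc ‖beta1 c' D‖ * ‖beta2 c' D‖ * ‖L1‖ * ‖r₃‖
        ≤ (2 * alpha D) * (4 * alpha D) * (4 * Real.exp (9 / 2) * ell D ^ 2) *
            (max C₄ 0 * alpha D * Real.log (ell D)) := by gcongr
      _ ≤ (2 * alpha D) * (4 * alpha D) * (4 * Real.exp (9 / 2) * ell D ^ 2) *
            (max C₄ 0 * alpha D * ell D) := by gcongr
      _ = 32 * Real.exp (9 / 2) * max C₄ 0 * (alpha D * ell D ^ 9) ^ 3 / ell D ^ 24 := by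
          field_simp; ring
      _ = 32 * Real.exp (9 / 2) * π ^ 3 * max C₄ 0 / ell D ^ 24 := by rw [hαℓ9]; ring
  -- term 2: `|(β₁r₂ + β₂r₁)(1+r₃)| ≤ 6π C₈ (1 + C₄π) / 𝓛²⁴`
  have T2 : ‖(beta1 c' D * r₂ + beta2 c' D * r₁) * (1 + r₃)‖ ≤
      6 * π * C₈ * (1 + max C₄ 0 * π) / ell D ^ 24 := by
    rw [norm_mul]
    have hsum : ‖beta1 c' D * r₂ + beta2 c' D * r₁‖ ≤ 6 * alpha D * (C₈ / ell D ^ 15) := by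
      refine (norm_add_le _ _).trans ?_
      rw [norm_mul, norm_mul]
      have i1 : ‖beta1 c' D‖ * ‖r₂‖ ≤ 2 * alpha D * (C₈ / ell D ^ 15) :=
        mul_le_mul hβ1 hr2' (norm_nonneg _) (by positivity)
      have i2 : ‖beta2 c' D‖ * ‖r₁‖ ≤ 4 * alpha D * (C₈ / ell D ^ 15) :=
        mul_le_mul hβ2 hr1' (norm_nonneg _) (by positivity)
      linarith
    calc ‖beta1 c' D * r₂ + beta2 c' D * r₁‖ * ‖1 + r₃‖
        ≤ 6 * alpha D * (C₈ / ell D ^ 15) * (1 + max C₄ 0 * π) :=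
          mul_le_mul hsum h1r3 (norm_nonneg _) (by positivity)
      _ = 6 * C₈ * (1 + max C₄ 0 * π) * (alpha D * ell D ^ 9) / ell D ^ 24 := by
          field_simp
      _ = 6 * π * C₈ * (1 + max C₄ 0 * π) / ell D ^ 24 := by rw [hαℓ9]; ring
  -- term 3: `|r₁r₂(1+r₃)/L′| ≤ C₈²(1+C₄π)/(c 𝓛³⁰) ≤ C₈²(1+C₄π)/(c 𝓛²⁴)`
  have T3 : ‖r₁ * r₂ * (1 + r₃) / L1‖ ≤ C₈ ^ 2 * (1 + max C₄ 0 * π) / c / ell D ^ 24 := by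
    rw [norm_div, norm_mul, norm_mul]
    have hnum : ‖r₁‖ * ‖r₂‖ * ‖1 + r₃‖ ≤ (C₈ / ell D ^ 15) * (C₈ / ell D ^ 15) * (1 + max C₄ 0 * π) := by
      have i1 : ‖r₁‖ * ‖r₂‖ ≤ (C₈ / ell D ^ 15) * (C₈ / ell D ^ 15) :=
        mul_le_mul hr1' hr2' (norm_nonneg _) (by positivity)
      exact mul_le_mul i1 h1r3 (norm_nonneg _) (by positivity)
    calc ‖r₁‖ * ‖r₂‖ * ‖1 + r₃‖ / ‖L1‖
        ≤ (C₈ / ell D ^ 15) * (C₈ / ell D ^ 15) * (1 + max C₄ 0 * π) / c := by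
          exact div_le_div₀ (by positivity) hnum hc hcL
      _ = C₈ ^ 2 * (1 + max C₄ 0 * π) / c / ell D ^ 30 := by field_simp
      _ ≤ C₈ ^ 2 * (1 + max C₄ 0 * π) / c / ell D ^ 24 := by
          refine div_le_div_of_nonneg_left (by positivity) (by positivity) ?_
          exact pow_le_pow_right₀ hℓ1 (by norm_num)
  calc ‖beta1 c' D * beta2 c' D * L1 * r₃ + (beta1 c' D * r₂ + beta2 c' D * r₁) * (1 + r₃) +
        r₁ * r₂ * (1 + r₃) / L1‖
      ≤ ‖beta1 c' D * beta2 c' D * L1 * r₃‖ + ‖(beta1 c' D * r₂ + beta2 c' D * r₁) * (1 + r₃)‖ +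
        ‖r₁ * r₂ * (1 + r₃) / L1‖ := by
          refine (norm_add_le _ _).trans ?_
          gcongr
          exact norm_add_le _ _
    _ ≤ 32 * Real.exp (9 / 2) * π ^ 3 * max C₄ 0 / ell D ^ 24 +
        6 * π * C₈ * (1 + max C₄ 0 * π) / ell D ^ 24 +
        C₈ ^ 2 * (1 + max C₄ 0 * π) / c / ell D ^ 24 := by linarith
    _ = _ := by rw [add_div, add_div]

/-- **Z22:§15.u058 from Assumption (A) with ANY exponent `E ≥ 15`** (`Repair.Bed.AssumptionAWith E`; the printed
(A) is `E = 2022`, under which this is the tree's node `Typed.Section15C.Step15_u058` via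
`Repair.Gap.forAllLarge_assumptionA_of_pow15`). [cite: Zhang2022LandauSiegel, §15 p. 88] -/
theorem step15_u058_of_assumptionAWith_of_lemma54
    (hX : ∀ (D : ℕ) [NeZero D] (χ : DirichletCharacter ℂ D),
      X.calR1star c' χ = χ.LFunction (1 + beta1 c' D) * χ.LFunction (1 + beta2 c' D) /
        deriv χ.LFunction 1 * deltaW D 1)
    {E : ℝ} (hE : 15 ≤ E) (h54 : Lemma54) :
    ∃ C : ℝ, ForAllLarge fun D _ χ => AssumptionAWith E D χ →
      ‖X.calR1star c' χ - beta1 c' D * beta2 c' D * deriv χ.LFunction 1‖ ≤ C / ell D ^ 24 := by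
  obtain ⟨C, h⟩ := step15_u058_pow15_of_lemma54 c' X hX h54
  exact ⟨C, forAllLarge_assumptionAWith_of_pow15 hE h⟩

end Literature.NumberTheory.LFunctions.Zhang2022.Repair.Gap
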